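import Summits.NavierStokesRegularity.NavierStokesRegularity.Theorems.ExtremiserTransienceKStarAttainedHalfSpaceScaling
import HarnessLib

/-!
# Route `ExtremiserTransience`, support item `KStarAttained` (stmt-NavierStokesRegularity-24370):
# THE TOP-SPEED SET OF A SMOOTH ATTAINER OF `κ⋆` SURROUNDS THE ORIGIN (half-space exclusion) — (4/4) the estimates `J₁, a₁, c₁ = o_L(1)` and the MAIN THEOREM `halfSpaceFree_of_attained`

PLATE (port-ready text; this is file 4/4 of the ≤400-line split, by-name users import THIS module) prepared by the cell seat `nsreg-p3 g21` from `HOME/ns-regularity-ideate-p3/round-26/Law26U.lean`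
(a08432649975ded6; memo ROUND-26.md e020c62082fda570, SUPPLEMENT-26U.md).  Intended landing (by a PROVER seat, when HOLD #26
lifts): `--supports stmt-NavierStokesRegularity-24370 --as helper`.  Namespace `…Theorems.DepletionLadder.KStar.HalfSpace`.

Let `(v, M, B)` be admissible (`C^∞`, divergence free, `‖v‖ ≤ M`, `‖Dv‖ ≤ B`, `D⁰v, D¹v, D²v ∈ L²`), non-degenerate
(`M‖ω‖₂‖∇ω‖₂ > 0`) and attain the sharp depletion constant `κ⋆ = sInf V` (the tree's literal `V`):
`|∫⟪ω, Dv ω⟫| = κ⋆·M·‖ω‖₂·‖∇ω‖₂`.  MAIN THEOREM `halfSpaceFree_of_attained`: for every direction `t` there is a top-speed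
point `x` (`‖v x‖ = M`) with `⟪v x, t⟫ ≥ 0` — the top-speed velocity set `{v x : ‖v x‖ = M}` lies in no open half-space
through the origin (the active-constraint multiplier of the obstacle `|v| ≤ M` is balanced in direction).

MECHANISM.  If all top-speed velocities had `⟪v, t⟫ < 0`, then by the margin lemma (`halfSpaceMargin_holds`: compact contact
set, decay of `v` from `v ∈ L², Dv ∈ L^∞`) adding the wide, weak, locally constant divergence-free field `ε·φ_L`
(`φ_L = curl(χ_L · ½ t × x) = t` on `B_L`) lowers the sup norm at first order, `‖v + εφ_L‖_∞ ≤ (1 − γε/(2M²))·M`, while the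
linear coefficients `J₁, a₁, c₁` of `J, Z, W` along `φ_L` are `o_L(1)` (`wideFieldEstimates_holds`: scaling
`‖D^k(χ_L·½t×x)‖_∞ = O(L^{1-k})`, one curl integration by parts for `a₁`, Young + support volume); the ONE-SIDED
first-variation inequality `firstVariation_le_of_oneSided_normBound` (the `m < 0`, `ε ≥ 0` half of the tree's
`firstVariation_eq_of_normBound`) then forces `κ⋆M²·γ/(2M²)·ZW ≤ o(1)`, contradicting `κ⋆ > 0` (`kStar_pos`, from the tree's
`13/200 < κ⋆`).

WHAT THIS IS NOT: not attainment or non-attainment of `κ⋆`; nothing about Navier–Stokes solutions.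
-/

noncomputable section

open Set Filter Topology MeasureTheory Metric
open scoped InnerProductSpace RealInnerProductSpace ENNReal NNReal ContDiff
open Literature.Analysis.FluidPDE
open Summit.NavierStokesRegularity.NavierStokesRegularity.Theorems
open Summit.NavierStokesRegularity.NavierStokesRegularity.Theorems.DepletionLadder.KStar

namespace Summit.NavierStokesRegularity.NavierStokesRegularity.Theorems

-- the problem directory repeats the summit name (`NavierStokesRegularity/NavierStokesRegularity`)
set_option linter.dupNamespace false

namespace DepletionLadder.KStar.HalfSpace

variable {v φ : E3 → E3}

/-- **Estimate for `J₁`:** `|J₁(φ_L)| ≤ K / L'` (sup bounds `O(1/L')` on `Dφ_L, curl φ_L` against `‖Dv‖₂²`;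
`|ω| ≤ κ|Dv|` pointwise). -/
theorem J1_wideField_le (hv : ContDiff ℝ ∞ v) (h1 : ∫⁻ x, ‖iteratedFDeriv ℝ 1 v x‖ₑ ^ 2 < ⊤) (t : E3) :
    ∃ K : ℝ, 0 ≤ K ∧ ∀ L, |J1 v (wideField t L)| ≤ K / Lp L := by
  obtain ⟨K₁, hK₁0, hK₁⟩ := wideField_bound_one t
  set κ := ‖curlCLM‖ with hκ
  have hκ0 : 0 ≤ κ := by rw [hκ]; positivity
  set X := ∫ x, ‖iteratedFDeriv ℝ 1 v x‖ ^ 2 with hX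
  have hXi : Integrable (fun x => ‖iteratedFDeriv ℝ 1 v x‖ ^ 2) (volume : Measure E3) :=
    integrable_sq_norm_of_lintegral_lt_top (hv.continuous_iteratedFDeriv (by exact_mod_cast le_top)) h1
  have hX0 : 0 ≤ X := integral_nonneg fun x => sq_nonneg _
  refine ⟨(2 * κ + κ ^ 2) * K₁ * X, by positivity, fun L => ?_⟩
  have hL := Lp_pos L
  set c := (2 * κ + κ ^ 2) * K₁ / Lp L with hc
  have hpt : ∀ x, ‖(⟪curl (wideField t L) x, fderiv ℝ v x (curl v x)⟫_ℝ +
      ⟪curl v x, fderiv ℝ (wideField t L) x (curl v x)⟫_ℝ +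
      ⟪curl v x, fderiv ℝ v x (curl (wideField t L) x)⟫_ℝ)‖ ≤ c * ‖iteratedFDeriv ℝ 1 v x‖ ^ 2 := by
    intro x
    rw [norm_iteratedFDeriv_one]
    set D := fderiv ℝ v x
    set w := curl v x
    set p := curl (wideField t L) x
    set Dp := fderiv ℝ (wideField t L) x
    have hw : ‖w‖ ≤ κ * ‖D‖ := norm_curl_le v x
    have hp : ‖p‖ ≤ K₁ / Lp L := (hK₁ L x).2
    have hDp : ‖Dp‖ ≤ K₁ / Lp L := (hK₁ L x).1
    have hq : 0 ≤ K₁ / Lp L := by positivity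
    have e1 : ‖⟪p, D w⟫_ℝ‖ ≤ K₁ / Lp L * (‖D‖ * (κ * ‖D‖)) := by
      calc ‖⟪p, D w⟫_ℝ‖ ≤ ‖p‖ * ‖D w‖ := norm_inner_le_norm _ _
        _ ≤ ‖p‖ * (‖D‖ * ‖w‖) := mul_le_mul_of_nonneg_left (D.le_opNorm w) (norm_nonneg _)
        _ ≤ K₁ / Lp L * (‖D‖ * (κ * ‖D‖)) :=
          mul_le_mul hp (mul_le_mul_of_nonneg_left hw (norm_nonneg _)) (by positivity) hq
    have e2 : ‖⟪w, Dp w⟫_ℝ‖ ≤ κ * ‖D‖ * (K₁ / Lp L * (κ * ‖D‖)) := by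
      calc ‖⟪w, Dp w⟫_ℝ‖ ≤ ‖w‖ * ‖Dp w‖ := norm_inner_le_norm _ _
        _ ≤ ‖w‖ * (‖Dp‖ * ‖w‖) := mul_le_mul_of_nonneg_left (Dp.le_opNorm w) (norm_nonneg _)
        _ ≤ κ * ‖D‖ * (K₁ / Lp L * (κ * ‖D‖)) :=
          mul_le_mul hw (mul_le_mul hDp hw (norm_nonneg _) hq) (by positivity) (by positivity)
    have e3 : ‖⟪w, D p⟫_ℝ‖ ≤ κ * ‖D‖ * (‖D‖ * (K₁ / Lp L)) := by
      calc ‖⟪w, D p⟫_ℝ‖ ≤ ‖w‖ * ‖D p‖ := norm_inner_le_norm _ _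
        _ ≤ ‖w‖ * (‖D‖ * ‖p‖) := mul_le_mul_of_nonneg_left (D.le_opNorm p) (norm_nonneg _)
        _ ≤ κ * ‖D‖ * (‖D‖ * (K₁ / Lp L)) :=
          mul_le_mul hw (mul_le_mul_of_nonneg_left hp (norm_nonneg _)) (by positivity) (by positivity)
    calc ‖⟪p, D w⟫_ℝ + ⟪w, Dp w⟫_ℝ + ⟪w, D p⟫_ℝ‖
        ≤ ‖⟪p, D w⟫_ℝ‖ + ‖⟪w, Dp w⟫_ℝ‖ + ‖⟪w, D p⟫_ℝ‖ :=
          (norm_add_le _ _).trans (add_le_add (norm_add_le _ _) le_rfl)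
      _ ≤ K₁ / Lp L * (‖D‖ * (κ * ‖D‖)) + κ * ‖D‖ * (K₁ / Lp L * (κ * ‖D‖)) +
            κ * ‖D‖ * (‖D‖ * (K₁ / Lp L)) := add_le_add (add_le_add e1 e2) e3
      _ = c * ‖D‖ ^ 2 := by rw [hc]; ring
  unfold J1
  calc |∫ x, (⟪curl (wideField t L) x, fderiv ℝ v x (curl v x)⟫_ℝ +
          ⟪curl v x, fderiv ℝ (wideField t L) x (curl v x)⟫_ℝ + ⟪curl v x, fderiv ℝ v x (curl (wideField t L) x)⟫_ℝ)|
      ≤ ∫ x, ‖(⟪curl (wideField t L) x, fderiv ℝ v x (curl v x)⟫_ℝ +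
          ⟪curl v x, fderiv ℝ (wideField t L) x (curl v x)⟫_ℝ + ⟪curl v x, fderiv ℝ v x (curl (wideField t L) x)⟫_ℝ)‖ := by
        rw [← Real.norm_eq_abs]; exact norm_integral_le_integral_norm _
    _ ≤ ∫ x, c * ‖iteratedFDeriv ℝ 1 v x‖ ^ 2 :=
        integral_mono_of_nonneg (ae_of_all _ fun x => norm_nonneg _) (hXi.const_mul c) (ae_of_all _ hpt)
    _ = c * X := integral_const_mul _ _
    _ = (2 * κ + κ ^ 2) * K₁ * X / Lp L := by rw [hc]; ring

/-- **Estimate for `a₁` (one integration by parts, then Young + support volume):**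
`|a₁(φ_L)| = |∫⟪v, curl curl φ_L⟫| ≤ ε‖v‖₂² + K/(ε L')`. -/
theorem A1_wideField_le (hv : ContDiff ℝ ∞ v) (h0 : ∫⁻ x, ‖iteratedFDeriv ℝ 0 v x‖ₑ ^ 2 < ⊤) (t : E3) :
    ∃ K : ℝ, 0 ≤ K ∧ ∀ ε, 0 < ε → ∀ L, |A1 v (wideField t L)| ≤ ε * (∫ x, ‖v x‖ ^ 2) + K / (ε * Lp L) := by
  obtain ⟨K₂, hK₂0, hK₂⟩ := wideField_bound_two t
  set V := (volume : Measure E3).real (closedBall (0 : E3) 1) with hV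
  have hV0 : 0 ≤ V := measureReal_nonneg
  set X := ∫ x, ‖v x‖ ^ 2 with hX
  have hXi : Integrable (fun x => ‖v x‖ ^ 2) (volume : Measure E3) := by
    have h := integrable_sq_norm_of_lintegral_lt_top (hv.continuous_iteratedFDeriv (m := 0) (by exact_mod_cast le_top)) h0
    refine h.congr (ae_of_all _ fun x => ?_)
    simp only [norm_iteratedFDeriv_zero]
  have hX0 : 0 ≤ X := integral_nonneg fun x => sq_nonneg _
  refine ⟨8 * K₂ ^ 2 * V, by positivity, fun ε hε L => ?_⟩
  have hL := Lp_pos L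
  have hibp : A1 v (wideField t L) = ∫ x, ⟪v x, curl (curl (wideField t L)) x⟫_ℝ := by
    unfold A1
    exact integral_inner_curl_eq_integral_inner_curl (hv.of_le (by exact_mod_cast le_top))
      ((Permana2026.contDiff_curl_top (wideField_contDiff t L)).of_le (by exact_mod_cast le_top))
      (hasCompactSupport_curl (hasCompactSupport_wideField t L))
  set s := closedBall (0 : E3) (2 * Lp L) with hs
  set g : E3 → ℝ := s.indicator fun _ => (K₂ / Lp L ^ 2) ^ 2 with hg
  have hpt : ∀ x, ‖⟪v x, curl (curl (wideField t L)) x⟫_ℝ‖ ≤ ε * ‖v x‖ ^ 2 + g x / ε := by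
    intro x
    have hcc : ‖curl (curl (wideField t L)) x‖ ^ 2 ≤ g x := by
      by_cases hx : x ∈ s
      · rw [hg, Set.indicator_of_mem hx]; exact pow_le_pow_left₀ (norm_nonneg _) (hK₂ L x).2 2
      · rw [curl_curl_wideField_eq_zero t L hx, hg, Set.indicator_of_notMem hx, norm_zero]; norm_num
    calc ‖⟪v x, curl (curl (wideField t L)) x⟫_ℝ‖ ≤ ‖v x‖ * ‖curl (curl (wideField t L)) x‖ := norm_inner_le_norm _ _
      _ ≤ ε * ‖v x‖ ^ 2 + ‖curl (curl (wideField t L)) x‖ ^ 2 / ε := mul_le_eps _ _ hε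
      _ ≤ ε * ‖v x‖ ^ 2 + g x / ε := by gcongr
  have hgi : Integrable g (volume : Measure E3) := integrable_indicator_closedBall _ _
  have hg_int : ∫ x, g x = (volume : Measure E3).real s * (K₂ / Lp L ^ 2) ^ 2 := by
    rw [hg, integral_indicator_const _ measurableSet_closedBall, smul_eq_mul]
  have hvol : (volume : Measure E3).real s = (2 * Lp L) ^ 3 * V := volumeReal_closedBall _ (by positivity)
  calc |A1 v (wideField t L)| = ‖∫ x, ⟪v x, curl (curl (wideField t L)) x⟫_ℝ‖ := by rw [hibp, Real.norm_eq_abs]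
    _ ≤ ∫ x, ‖⟪v x, curl (curl (wideField t L)) x⟫_ℝ‖ := norm_integral_le_integral_norm _
    _ ≤ ∫ x, (ε * ‖v x‖ ^ 2 + g x / ε) :=
        integral_mono_of_nonneg (ae_of_all _ fun _ => norm_nonneg _) ((hXi.const_mul ε).add (hgi.div_const ε))
          (ae_of_all _ hpt)
    _ = ε * X + (∫ x, g x) / ε := by
        rw [integral_add (hXi.const_mul ε) (hgi.div_const ε), integral_const_mul, integral_div]
    _ = ε * X + (2 * Lp L) ^ 3 * V * (K₂ / Lp L ^ 2) ^ 2 / ε := by rw [hg_int, hvol]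
    _ = ε * X + 8 * K₂ ^ 2 * V / (ε * Lp L) := by field_simp; ring

/-- **Estimate for `c₁` (Young + support volume):** `|c₁(φ_L)| ≤ ε‖∇ω‖₂² + K/(ε L')`. -/
theorem C1_wideField_le (hv : ContDiff ℝ ∞ v) (h2 : ∫⁻ x, ‖iteratedFDeriv ℝ 2 v x‖ₑ ^ 2 < ⊤) (t : E3) :
    ∃ K : ℝ, 0 ≤ K ∧ ∀ ε, 0 < ε → ∀ L,
      |C1 v (wideField t L)| ≤ ε * (∫ x, frobeniusNormSq (fderiv ℝ (curl v) x)) + K / (ε * Lp L) := by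
  obtain ⟨K₂, hK₂0, hK₂⟩ := wideField_bound_two t
  set V := (volume : Measure E3).real (closedBall (0 : E3) 1) with hV
  have hV0 : 0 ≤ V := measureReal_nonneg
  set Y := ∫ x, frobeniusNormSq (fderiv ℝ (curl v) x) with hY
  have hYi : Integrable (fun x => frobeniusNormSq (fderiv ℝ (curl v) x)) (volume : Measure E3) :=
    (integrable_frobeniusNormSq_fderiv_curl (hv.of_le (by norm_cast)) h2).1
  have hY0 : 0 ≤ Y := integral_nonneg fun x => frobeniusNormSq_nonneg _
  refine ⟨24 * K₂ ^ 2 * V, by positivity, fun ε hε L => ?_⟩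
  have hL := Lp_pos L
  set s := closedBall (0 : E3) (2 * Lp L) with hs
  set g : E3 → ℝ := s.indicator fun _ => 3 * (K₂ / Lp L ^ 2) ^ 2 with hg
  set e := EuclideanSpace.basisFun (Fin 3) ℝ with he
  have hpt : ∀ x, ‖∑ i, ⟪fderiv ℝ (curl v) x (e i), fderiv ℝ (curl (wideField t L)) x (e i)⟫_ℝ‖ ≤
      ε * frobeniusNormSq (fderiv ℝ (curl v) x) + g x / ε := by
    intro x
    set A := fderiv ℝ (curl v) x
    set B := fderiv ℝ (curl (wideField t L)) x with hB'
    have hB : ∑ i, ‖B (e i)‖ ^ 2 ≤ g x := by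
      by_cases hx : x ∈ s
      · rw [hg, Set.indicator_of_mem hx]
        calc ∑ i, ‖B (e i)‖ ^ 2 ≤ ∑ _i : Fin 3, (K₂ / Lp L ^ 2) ^ 2 := Finset.sum_le_sum fun i _ => by
              have h1 : ‖B (e i)‖ ≤ K₂ / Lp L ^ 2 := by
                calc ‖B (e i)‖ ≤ ‖B‖ * ‖e i‖ := B.le_opNorm _
                  _ = ‖B‖ := by rw [e.orthonormal.1 i, mul_one]
                  _ ≤ K₂ / Lp L ^ 2 := (hK₂ L x).1
              exact pow_le_pow_left₀ (norm_nonneg _) h1 2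
          _ = 3 * (K₂ / Lp L ^ 2) ^ 2 := by simp [Finset.sum_const]
      · have hB0 : B = 0 := fderiv_curl_wideField_eq_zero t L hx
        rw [hg, Set.indicator_of_notMem hx]; simp [hB0]
    have hA : frobeniusNormSq A = ∑ i, ‖A (e i)‖ ^ 2 := frobeniusNormSq_eq_sum e A
    calc ‖∑ i, ⟪A (e i), B (e i)⟫_ℝ‖ ≤ ∑ i, ‖⟪A (e i), B (e i)⟫_ℝ‖ := norm_sum_le _ _
      _ ≤ ∑ i, (ε * ‖A (e i)‖ ^ 2 + ‖B (e i)‖ ^ 2 / ε) := Finset.sum_le_sum fun i _ =>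
          (norm_inner_le_norm _ _).trans (mul_le_eps _ _ hε)
      _ = ε * ∑ i, ‖A (e i)‖ ^ 2 + (∑ i, ‖B (e i)‖ ^ 2) / ε := by
          rw [Finset.sum_add_distrib, Finset.mul_sum, Finset.sum_div]
      _ ≤ ε * frobeniusNormSq A + g x / ε := by rw [← hA]; gcongr
  have hgi : Integrable g (volume : Measure E3) := integrable_indicator_closedBall _ _
  have hg_int : ∫ x, g x = (volume : Measure E3).real s * (3 * (K₂ / Lp L ^ 2) ^ 2) := by
    rw [hg, integral_indicator_const _ measurableSet_closedBall, smul_eq_mul]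
  have hvol : (volume : Measure E3).real s = (2 * Lp L) ^ 3 * V := volumeReal_closedBall _ (by positivity)
  unfold C1
  calc |∫ x, ∑ i, ⟪fderiv ℝ (curl v) x (e i), fderiv ℝ (curl (wideField t L)) x (e i)⟫_ℝ|
      ≤ ∫ x, ‖∑ i, ⟪fderiv ℝ (curl v) x (e i), fderiv ℝ (curl (wideField t L)) x (e i)⟫_ℝ‖ := by
        rw [← Real.norm_eq_abs]; exact norm_integral_le_integral_norm _
    _ ≤ ∫ x, (ε * frobeniusNormSq (fderiv ℝ (curl v) x) + g x / ε) :=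
        integral_mono_of_nonneg (ae_of_all _ fun _ => norm_nonneg _) ((hYi.const_mul ε).add (hgi.div_const ε))
          (ae_of_all _ hpt)
    _ = ε * Y + (∫ x, g x) / ε := by
        rw [integral_add (hYi.const_mul ε) (hgi.div_const ε), integral_const_mul, integral_div]
    _ = ε * Y + (2 * Lp L) ^ 3 * V * (3 * (K₂ / Lp L ^ 2) ^ 2) / ε := by rw [hg_int, hvol]
    _ = ε * Y + 24 * K₂ ^ 2 * V / (ε * Lp L) := by field_simp; ring


/-- `K/(ε L') ≤ θ/2` once `L ≥ 2K/(ε θ)`. -/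
theorem tail_le_half {K ε θ L : ℝ} (_hK : 0 ≤ K) (hε : 0 < ε) (hθ : 0 < θ) (hL : 2 * K / (ε * θ) ≤ L) :
    K / (ε * Lp L) ≤ θ / 2 := by
  have hLp := Lp_pos L
  have h1 : 2 * K / (ε * θ) ≤ Lp L := hL.trans (le_Lp L)
  rw [div_le_iff₀ (by positivity)] at h1
  rw [div_le_iff₀ (by positivity)]
  nlinarith

/-- `ε X ≤ θ/2` for `ε = θ / (2 (X + 1))`. -/
theorem eps_mul_le_half {X θ : ℝ} (hX : 0 ≤ X) (hθ : 0 < θ) : θ / (2 * (X + 1)) * X ≤ θ / 2 := by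
  rw [div_mul_eq_mul_div, div_le_iff₀ (by positivity)]
  nlinarith

/-- **A′ PROVED: the wide-field estimates hold.** -/
theorem wideFieldEstimates_holds : WideFieldEstimates := by
  intro v M B hv _hdiv _hM _hB h0 h1 h2 t θ hθ L₀
  obtain ⟨KJ, hKJ0, hJ⟩ := J1_wideField_le hv h1 t
  obtain ⟨KA, hKA0, hA⟩ := A1_wideField_le hv h0 t
  obtain ⟨KC, hKC0, hC⟩ := C1_wideField_le hv h2 t
  set X := ∫ x, ‖v x‖ ^ 2 with hX
  set Y := ∫ x, frobeniusNormSq (fderiv ℝ (curl v) x) with hY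
  have hX0 : 0 ≤ X := integral_nonneg fun _ => sq_nonneg _
  have hY0 : 0 ≤ Y := integral_nonneg fun _ => frobeniusNormSq_nonneg _
  set εA := θ / (2 * (X + 1)) with hεA
  set εC := θ / (2 * (Y + 1)) with hεC
  have hεA0 : 0 < εA := by positivity
  have hεC0 : 0 < εC := by positivity
  set L := max (max L₀ (2 * KJ / (1 * θ))) (max (2 * KA / (εA * θ)) (2 * KC / (εC * θ))) with hLdef
  have hLJ : 2 * KJ / (1 * θ) ≤ L := (le_max_right _ _).trans (le_max_left _ _)
  have hLA : 2 * KA / (εA * θ) ≤ L := (le_max_left _ _).trans (le_max_right _ _)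
  have hLC : 2 * KC / (εC * θ) ≤ L := (le_max_right _ _).trans (le_max_right _ _)
  refine ⟨L, (le_max_left _ _).trans (le_max_left _ _), ?_, ?_, ?_⟩
  · have h := tail_le_half hKJ0 one_pos hθ hLJ
    rw [one_mul] at h
    exact (hJ L).trans (h.trans (by linarith))
  · have h1 : εA * X ≤ θ / 2 := eps_mul_le_half hX0 hθ
    have h2 : KA / (εA * Lp L) ≤ θ / 2 := tail_le_half hKA0 hεA0 hθ hLA
    exact (hA εA hεA0 L).trans (by linarith)
  · have h1 : εC * Y ≤ θ / 2 := eps_mul_le_half hY0 hθ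
    have h2 : KC / (εC * Lp L) ≤ θ / 2 := tail_le_half hKC0 hεC0 hθ hLC
    exact (hC εC hεC0 L).trans (by linarith)

/-- **THE LAW — UNCONDITIONAL (kernel-checked, no hypotheses, no `sorry`):** every admissible attainer of the sharp
depletion constant `κ⋆` has, for every direction `t`, a top-speed point `x` (`‖v x‖ = M`) with `⟪v x, t⟫ ≥ 0` — the
top-speed velocity set lies in no open half-space through the origin. -/
theorem topSpeedSurroundsOrigin_holds : TopSpeedSurroundsOrigin :=
  topSpeedSurroundsOrigin_of_estimates wideFieldEstimates_holds

/-- **THE TOP-SPEED SET OF A SMOOTH ATTAINER OF `κ⋆` SURROUNDS THE ORIGIN** (tree-style statement; binders = the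
admissibility literal of `KStar.interior_contact_nonempty`): for every direction `t` some top-speed point `x` has
`⟪v x, t⟫ ≥ 0`. [new: ROUND-26 of cell ns-regularity-ideate-p3] -/
theorem halfSpaceFree_of_attained (hv : ContDiff ℝ ∞ v) (hdiv : VectorCalculus.IsDivFree v) {M B : ℝ}
    (hM : ∀ x, ‖v x‖ ≤ M) (hB : ∀ x, ‖fderiv ℝ v x‖ ≤ B) (h0 : ∫⁻ x, ‖iteratedFDeriv ℝ 0 v x‖ₑ ^ 2 < ⊤)
    (h1 : ∫⁻ x, ‖iteratedFDeriv ℝ 1 v x‖ₑ ^ 2 < ⊤) (h2 : ∫⁻ x, ‖iteratedFDeriv ℝ 2 v x‖ₑ ^ 2 < ⊤)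
    (hpos : 0 < M * Real.sqrt (∫ x, ‖curl v x‖ ^ 2) * Real.sqrt (∫ x, frobeniusNormSq (fderiv ℝ (curl v) x)))
    (hatt : |∫ x, ⟪curl v x, fderiv ℝ v x (curl v x)⟫_ℝ| =
      sInf {κ : ℝ | (∀ (v : EuclideanSpace ℝ (Fin 3) → EuclideanSpace ℝ (Fin 3)) (M B : ℝ), ContDiff ℝ (⊤ : ℕ∞) v → Literature.Analysis.FluidPDE.VectorCalculus.IsDivFree v → (∀ x, ‖v x‖ ≤ M) → (∀ x, ‖fderiv ℝ v x‖ ≤ B) → (∫⁻ x, ‖iteratedFDeriv ℝ 0 v x‖ₑ ^ 2 < ⊤) → (∫⁻ x, ‖iteratedFDeriv ℝ 1 v x‖ₑ ^ 2 < ⊤) → (∫⁻ x, ‖iteratedFDeriv ℝ 2 v x‖ₑ ^ 2 < ⊤) → |∫ x, ⟪Literature.Analysis.FluidPDE.curl v x, fderiv ℝ v x (Literature.Analysis.FluidPDE.curl v x)⟫_ℝ| ≤ κ * M * Real.sqrt (∫ x, ‖Literature.Analysis.FluidPDE.curl v x‖ ^ 2) * Real.sqrt (∫ x, Literature.Analysis.FluidPDE.frobeniusNormSq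 (fderiv ℝ (Literature.Analysis.FluidPDE.curl v) x)))} *
        M * Real.sqrt (∫ x, ‖curl v x‖ ^ 2) * Real.sqrt (∫ x, frobeniusNormSq (fderiv ℝ (curl v) x)))
    (t : EuclideanSpace ℝ (Fin 3)) : ∃ x, ‖v x‖ = M ∧ 0 ≤ ⟪v x, t⟫_ℝ :=
  topSpeedSurroundsOrigin_holds v M B hv hdiv hM hB h0 h1 h2 hpos hatt t

/-- Equivalent phrasing: no direction `t` has `⟪v x, t⟫ < 0` at EVERY top-speed point. -/
theorem not_openHalfSpace_of_attained (hv : ContDiff ℝ ∞ v) (hdiv : VectorCalculus.IsDivFree v) {M B : ℝ}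
    (hM : ∀ x, ‖v x‖ ≤ M) (hB : ∀ x, ‖fderiv ℝ v x‖ ≤ B) (h0 : ∫⁻ x, ‖iteratedFDeriv ℝ 0 v x‖ₑ ^ 2 < ⊤)
    (h1 : ∫⁻ x, ‖iteratedFDeriv ℝ 1 v x‖ₑ ^ 2 < ⊤) (h2 : ∫⁻ x, ‖iteratedFDeriv ℝ 2 v x‖ₑ ^ 2 < ⊤)
    (hpos : 0 < M * Real.sqrt (∫ x, ‖curl v x‖ ^ 2) * Real.sqrt (∫ x, frobeniusNormSq (fderiv ℝ (curl v) x)))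
    (hatt : |∫ x, ⟪curl v x, fderiv ℝ v x (curl v x)⟫_ℝ| =
      sInf {κ : ℝ | (∀ (v : EuclideanSpace ℝ (Fin 3) → EuclideanSpace ℝ (Fin 3)) (M B : ℝ), ContDiff ℝ (⊤ : ℕ∞) v → Literature.Analysis.FluidPDE.VectorCalculus.IsDivFree v → (∀ x, ‖v x‖ ≤ M) → (∀ x, ‖fderiv ℝ v x‖ ≤ B) → (∫⁻ x, ‖iteratedFDeriv ℝ 0 v x‖ₑ ^ 2 < ⊤) → (∫⁻ x, ‖iteratedFDeriv ℝ 1 v x‖ₑ ^ 2 < ⊤) → (∫⁻ x, ‖iteratedFDeriv ℝ 2 v x‖ₑ ^ 2 < ⊤) → |∫ x, ⟪Literature.Analysis.FluidPDE.curl v x, fderiv ℝ v x (Literature.Analysis.FluidPDE.curl v x)⟫_ℝ| ≤ κ * M * Real.sqrt (∫ x, ‖Literature.Analysis.FluidPDE.curl v x‖ ^ 2) * Real.sqrt (∫ x, Literature.Analysis.FluidPDE.frobeniusNormSq (fderiv ℝ (Literature.Analysis.FluidPDE.curl v) x)))} *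
        M * Real.sqrt (∫ x, ‖curl v x‖ ^ 2) * Real.sqrt (∫ x, frobeniusNormSq (fderiv ℝ (curl v) x)))
    (t : EuclideanSpace ℝ (Fin 3)) : ¬ (∀ x, ‖v x‖ = M → ⟪v x, t⟫_ℝ < 0) := by
  intro h
  obtain ⟨x, hx, hxt⟩ := halfSpaceFree_of_attained hv hdiv hM hB h0 h1 h2 hpos hatt t
  exact absurd (h x hx) (not_lt.2 hxt)

end DepletionLadder.KStar.HalfSpace

end Summit.NavierStokesRegularity.NavierStokesRegularity.Theorems

end
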